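import Literature.Computability.Complexity.DrivenSignMachineStream
import HarnessLib

/-!
# Sign queries are insensitive to padding: fixed-length probes for the driven sign machine

Topic `Literature/Computability/Complexity`, grouping namespace `FKTransfer`. The driven sign
machine (`DrivenSignMachine*.lean`) probes, in each frame, the integer affine form coded by the
LAST `m(n)` answer bits, so a driver must deliver codes of length EXACTLY `m(n)`, whereas the code
`encodingIntBool.listBool.encode [c, a₀, …, a_{n-1}]` of a form (the query format of
`AdditiveRealClasses.signOracle`) has a length depending on the coefficients. This file shows that
padding is harmless: the decoder of `listBool` codes reads the unary length header and then that
many self-delimited items, ignoring whatever follows (`listBool_decode_encode_append`), so the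
value, the sign oracle and the sign environment of a padded code are those of the code
(`affineQueryValue_encode_append`, `signOracle_encode_append`, `signEnv_rightpad` for core's
`List.rightpad k false`, whose length is `max k |w|`, `List.length_rightpad`).

## References

* H. Fournier, P. Koiran, *Lower bounds are not easier over the reals: inside PH*, ICALP 2000,
  LNCS 1853 = LIP RR-1999-21, §2.2 (all tests have coefficients of polynomial size, so their codes
  fit a fixed polynomial length). [FournierKoiran2000]
* S. Arora, B. Barak, *Computational Complexity: A Modern Approach*, CUP 2009, §0.1 (self-delimiting
  codes of tuples). [AroraBarak2009]
-/

namespace Literature.Computability.Complexity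

namespace FKTransfer

open _root_.Computability

variable {α : Type}

/-! ### Pairs and lists followed by junk -/

/-- A pair code followed by junk is the pair code with the junk in the second component (private
copy of a lemma several files of the tree re-prove locally). [folklore] -/
private theorem boolPair_append (x y z : List Bool) : boolPair x y ++ z = boolPair x (y ++ z) := by
  simp [boolPair, List.append_assoc]

/-- Unpairing a pair code followed by junk. [folklore] -/
private theorem boolUnpair_boolPair_append (x y z : List Bool) : boolUnpair (boolPair x y ++ z) = (x, y ++ z) := by
  rw [boolPair_append, boolUnpair_boolPair]

/-- The fuelled list decoder reads its items off the body and ignores the junk after them.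
[cite: AroraBarak2009, §0.1] -/
theorem listBoolDecode_foldr_append (e : Encoding α Bool) (l : List α) (pad : List Bool) :
    listBoolDecode e l.length (l.foldr (fun a acc => boolPair (e.encode a) acc) [] ++ pad) = some l := by
  induction l with
  | nil => rfl
  | cons a l ih =>
    rw [List.foldr_cons, boolPair_append, List.length_cons, listBoolDecode, boolUnpair_boolPair]
    simp [e.decode_encode, ih]

/-- **A list code followed by junk decodes to the list.** [cite: AroraBarak2009, §0.1] -/
theorem listBool_decode_encode_append (e : Encoding α Bool) (l : List α) (pad : List Bool) :
    e.listBool.decode (e.listBool.encode l ++ pad) = some l := by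
  change listBoolDecode e (unaryDecodeNat (boolUnpair (boolPair (unaryEncodeNat l.length) _ ++ pad)).1)
    (boolUnpair (boolPair (unaryEncodeNat l.length) _ ++ pad)).2 = some l
  rw [boolUnpair_boolPair_append, unary_decode_encode_nat]
  exact listBoolDecode_foldr_append e l pad

/-! ### Padded sign queries -/

variable {n : ℕ}

/-- **The value of a padded query is the value of the query.** [cite: FournierKoiran2000, §2 Remark 1] -/
theorem affineQueryValue_encode_append (x : Fin n → ℝ) (l : List ℤ) (pad : List Bool) :
    affineQueryValue x ((encodingIntBool.listBool).encode l ++ pad) =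
      affineQueryValue x ((encodingIntBool.listBool).encode l) := by
  simp only [affineQueryValue, listBool_decode_encode_append, Encoding.decode_encode]

/-- The sign oracle on a padded query. [cite: FournierKoiran2000, §2 Remark 1] -/
theorem signOracle_encode_append (x : Fin n → ℝ) (l : List ℤ) (pad : List Bool) :
    signOracle x ((encodingIntBool.listBool).encode l ++ pad) = signOracle x ((encodingIntBool.listBool).encode l) := by
  rw [signOracle_apply, signOracle_apply, affineQueryValue_encode_append]

/-- The sign environment on a padded query. [folklore] -/
theorem signEnv_encode_append (x : Fin n → ℝ) (l : List ℤ) (pad : List Bool) :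
    signEnv x ((encodingIntBool.listBool).encode l ++ pad) = signEnv x ((encodingIntBool.listBool).encode l) := by
  rw [signEnv, signEnv, affineQueryValue_encode_append]

/-- **The sign environment of a right-padded form code is that of the form** (padding by core's
`List.rightpad k false`), with the explicit value `[0 ≤ c + ∑ aᵢ xᵢ]` for the code of
`l = [c, a₀, …]`. [cite: FournierKoiran2000, §2 Remark 1] -/
theorem signEnv_rightpad (x : Fin n → ℝ) (l : List ℤ) (k : ℕ) :
    signEnv x (List.rightpad k false ((encodingIntBool.listBool).encode l)) =
      decide ((0 : ℝ) ≤ ((l.getD 0 0 : ℤ) : ℝ) + ∑ i : Fin n, ((l.getD (i.val + 1) 0 : ℤ) : ℝ) * x i) := by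
  rw [List.rightpad, signEnv_encode_append, signEnv, affineQueryValue_encode]

end FKTransfer

end Literature.Computability.Complexity
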